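import Mathlib
import HarnessLib
import Literature.MathematicalPhysics.StatisticalMechanics.TorusFRDKernels
import Literature.MathematicalPhysics.StatisticalMechanics.TorusFRDFourier

/-!
# Re-periodisation of a finite-range kernel from the torus `(ℤ/M)^d` to a smaller torus `(ℤ/M̄)^d`,
# `M = r M̄`: sites lift by the symmetric representative, modes lift by `κ' ↦ r κ'`, and the nonzero
# multipliers of the re-periodised kernel are a SUBSET of those of the original ([Buc16] Lemma 4.1)

For the volume-uniform [ABKM19] Lemma 8.4 an `X`-local functional on the torus `T_N = (ℤ/L^N)^d` is
evaluated under the step measure of a SMALLER torus `T_{N̄}` (`M̄ = L^{N̄}`, `M = L^N = r M̄`) carrying the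
re-periodised step kernel `𝒞̄ = 𝒞 ∘ lift` ([Buc16] Lemma 4.1 and the display before (4.37): "by
construction `𝒟̂_{A,k+1,N̄}(p) = 𝒞̂_{A,k+1}(p)` for `p ∈ T̂_{N̄}`").  This file is the arithmetic of that
construction, for a kernel `𝒞` on `(ℤ/M)^d` that is CONSTANT (`= c₀`) outside the sup-norm ball of
radius `M̄/2` (finite range, clause (iii) of `TorusFRD`), `M̄` odd, `M = r M̄`:

* `liftSite z = (z̃_i mod M)_i` (symmetric representatives), `liftMode r κ' = (r κ̃'_i mod M)_i`;
* `valMinAbs_liftSite`, `valMinAbs_liftMode`, `dualMomentum_liftMode` (`p(r κ') = p(κ')`),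
  `momNorm_liftMode`, `inShell_liftMode_iff`, `liftMode_eq_zero_iff`;
* `torusChar_liftMode_liftSite` — `χ_{rκ'}(z̃) = χ_{κ'}(z)`;
* `liftSite_injective`, `liftSite_neg`, `exists_liftSite_of_supNorm_le` (the image of `liftSite` is the
  sup-norm ball of radius `M̄/2`);
* **`fourierCoeff_comp_liftSite`** — `(𝒞 ∘ lift)^(κ') = 𝒞̂(r κ') − c₀ (M^d 1[κ'=0] − M̄^d 1[κ'=0])`, in
  particular **`fourierCoeff_comp_liftSite_of_ne_zero`**: `(𝒞 ∘ lift)^(κ') = 𝒞̂(r κ')` for `κ' ≠ 0`;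
* `castHom` projection `proj`: `liftSite (proj v) = v` on the ball, and the covariance identity
  **`comp_liftSite_proj_sub`**: `(𝒞 ∘ lift)(proj x − proj y) = 𝒞(x − y)` whenever `|x − y|_∞ ≤ M̄/2`.

Everything is proved; no named fact.

## References
* S. Buchholz, J. Funct. Anal. 275 (2018), Lemma 4.1 and the proof of Thm 4.5 [Buchholz2016].
* S. Adams, S. Buchholz, R. Kotecký, S. Müller, arXiv:1910.13564, Lemma 8.4 [AdamsBuchholzKoteckyMuller2019].
-/

noncomputable section

namespace Literature.MathematicalPhysics.StatisticalMechanics.GradientFRD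

open Finset Complex Literature.Probability.LatticeModels
open scoped Real ComplexConjugate BigOperators

variable {d M Mb : ℕ} [NeZero M] [NeZero Mb]

/-! ## Lifting sites and modes -/

/-- The lift of a site of the small torus `(ℤ/M̄)^d` to the big torus `(ℤ/M)^d` by symmetric
representatives: `(lift z)_i = z̃_i mod M`. [cite: Buchholz2016, Lemma 4.1 (the map τ)] -/
def liftSite (M : ℕ) (z : Fin d → ZMod Mb) : Fin d → ZMod M := fun i => ((z i).valMinAbs : ZMod M)

/-- The lift of a mode of the small dual torus: `(liftMode r κ')_i = r κ̃'_i mod M` (for `M = r M̄` the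
dual momentum is unchanged). [cite: Buchholz2016, Lemma 4.1 / proof of Thm 4.5] -/
def liftMode (M r : ℕ) (κ : Fin d → ZMod Mb) : Fin d → ZMod M := fun i => (((r : ℤ) * (κ i).valMinAbs : ℤ) : ZMod M)

/-- The symmetric representative survives the lift of sites (`M̄ ≤ M`). [cite: Buchholz2016, Lemma 4.1] -/
theorem valMinAbs_liftSite (hle : Mb ≤ M) (z : Fin d → ZMod Mb) (i : Fin d) :
    ((liftSite M z) i).valMinAbs = (z i).valMinAbs := by
  rw [liftSite, ZMod.valMinAbs_spec]
  refine ⟨rfl, ?_⟩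
  have h := ZMod.valMinAbs_mem_Ioc (z i)
  have hle' : (Mb : ℤ) ≤ M := by exact_mod_cast hle
  exact ⟨by linarith [h.1], h.2.trans hle'⟩

/-- The symmetric representative of a lifted mode is `r κ̃'_i` (`M = r M̄`, `r ≥ 1`).
[cite: Buchholz2016, Lemma 4.1] -/
theorem valMinAbs_liftMode {r : ℕ} (hr : 1 ≤ r) (hM : M = r * Mb) (κ : Fin d → ZMod Mb) (i : Fin d) :
    ((liftMode M r κ) i).valMinAbs = (r : ℤ) * (κ i).valMinAbs := by
  rw [liftMode, ZMod.valMinAbs_spec]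
  refine ⟨rfl, ?_⟩
  have h := ZMod.valMinAbs_mem_Ioc (κ i)
  have hr' : (1 : ℤ) ≤ r := by exact_mod_cast hr
  have hM' : (M : ℤ) = r * Mb := by rw [hM]; push_cast; ring
  rw [hM']
  constructor
  · have := h.1; nlinarith
  · have := h.2; nlinarith

/-- **The dual momentum is unchanged by the lift of modes**: `p(liftMode r κ') = p(κ')` for `M = r M̄`.
[cite: Buchholz2016, Lemma 4.1] -/
theorem dualMomentum_liftMode {r : ℕ} (hr : 1 ≤ r) (hM : M = r * Mb) (κ : Fin d → ZMod Mb) :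
    dualMomentum (liftMode M r κ) = dualMomentum κ := by
  funext i
  simp only [dualMomentum]
  rw [valMinAbs_liftMode hr hM κ i, hM]
  have hr0 : (r : ℝ) ≠ 0 := by exact_mod_cast (show r ≠ 0 by omega)
  have hMb : (Mb : ℝ) ≠ 0 := by exact_mod_cast NeZero.ne Mb
  push_cast
  field_simp

/-- `|p(liftMode r κ')| = |p(κ')|`. [cite: Buchholz2016, Lemma 4.1] -/
theorem momNorm_liftMode {r : ℕ} (hr : 1 ≤ r) (hM : M = r * Mb) (κ : Fin d → ZMod Mb) :
    momNorm (liftMode M r κ) = momNorm κ := by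
  simp only [momNorm, dualMomentum_liftMode hr hM]

/-- **Shells are preserved by the lift of modes.** [cite: Buchholz2016, proof of Thm 4.5 (𝔸_j^{N̄} ⊂ T̂_{N̄})] -/
theorem inShell_liftMode_iff {r : ℕ} (hr : 1 ≤ r) (hM : M = r * Mb) (L j : ℕ) (κ : Fin d → ZMod Mb) :
    InShell L j (liftMode M r κ) ↔ InShell L j κ := by
  simp only [InShell, momNorm_liftMode hr hM]

/-- `liftMode r κ' = 0 ↔ κ' = 0`. [cite: Buchholz2016, Lemma 4.1] -/
theorem liftMode_eq_zero_iff {r : ℕ} (hr : 1 ≤ r) (hM : M = r * Mb) (κ : Fin d → ZMod Mb) :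
    liftMode M r κ = 0 ↔ κ = 0 := by
  constructor
  · intro h
    funext i
    have hi : ((liftMode M r κ) i).valMinAbs = 0 := by rw [h]; exact ZMod.valMinAbs_zero _
    rw [valMinAbs_liftMode hr hM] at hi
    have hr0 : (r : ℤ) ≠ 0 := by exact_mod_cast (show r ≠ 0 by omega)
    have : (κ i).valMinAbs = 0 := by
      rcases mul_eq_zero.1 hi with h1 | h1
      · exact absurd h1 hr0
      · exact h1
    exact (ZMod.valMinAbs_eq_zero _).1 this
  · intro h
    subst h
    funext i
    simp [liftMode]

/-- **The characters agree**: `χ_{liftMode r κ'}(liftSite z) = χ_{κ'}(z)` for `M = r M̄`.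
[cite: Buchholz2016, Lemma 4.1] -/
theorem torusChar_liftMode_liftSite {r : ℕ} (hr : 1 ≤ r) (hM : M = r * Mb) (hle : Mb ≤ M)
    (κ z : Fin d → ZMod Mb) :
    torusChar (liftMode M r κ) (liftSite M z) = torusChar κ z := by
  unfold torusChar
  refine prod_congr rfl fun i _ => ?_
  rw [stdAddChar_mul_eq_cexp_valMinAbs, stdAddChar_mul_eq_cexp_valMinAbs, valMinAbs_liftMode hr hM,
    valMinAbs_liftSite hle]
  congr 1
  have hr0 : (r : ℂ) ≠ 0 := by exact_mod_cast (show r ≠ 0 by omega)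
  have hMb : (Mb : ℂ) ≠ 0 := by exact_mod_cast NeZero.ne Mb
  rw [hM]
  push_cast
  field_simp

/-! ## The image of the lift of sites -/

/-- The lift of sites is injective (`M̄ ≤ M`). [cite: Buchholz2016, Lemma 4.1] -/
theorem liftSite_injective (hle : Mb ≤ M) : Function.Injective (liftSite (d := d) (Mb := Mb) M) := by
  intro z z' h
  funext i
  have := congrFun h i
  have h1 := valMinAbs_liftSite hle z i
  have h2 := valMinAbs_liftSite hle z' i
  rw [this] at h1
  exact ZMod.valMinAbs_inj.1 (h1.symm.trans h2 ▸ rfl)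

omit [NeZero M] [NeZero Mb] in
/-- The lift commutes with negation when `M̄` is odd. [cite: Buchholz2016, Lemma 4.1] -/
theorem liftSite_neg (hodd : Odd Mb) (z : Fin d → ZMod Mb) : liftSite M (-z) = -liftSite M z := by
  funext i
  simp only [liftSite, Pi.neg_apply]
  have hne : 2 * (z i).val ≠ Mb := by
    intro h
    exact (Nat.not_even_iff_odd.2 hodd) ⟨(z i).val, by omega⟩
  rw [ZMod.valMinAbs_neg_of_ne_half hne]
  push_cast
  ring

omit [NeZero M] [NeZero Mb] in
/-- A kernel composed with the lift inherits evenness (`M̄` odd). [cite: Buchholz2016, Lemma 4.1] -/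
theorem comp_liftSite_even (hodd : Odd Mb) {𝒞 : (Fin d → ZMod M) → ℝ} (heven : ∀ x, 𝒞 (-x) = 𝒞 x)
    (z : Fin d → ZMod Mb) : 𝒞 (liftSite M (-z)) = 𝒞 (liftSite M z) := by
  rw [liftSite_neg hodd, heven]

/-- The lifted sites lie in the sup-norm ball of radius `M̄/2`. [cite: Buchholz2016, Lemma 4.1] -/
theorem supNorm_liftSite_le (hle : Mb ≤ M) (z : Fin d → ZMod Mb) : supNorm (liftSite M z) ≤ Mb / 2 := by
  unfold supNorm
  refine Finset.sup_le fun i _ => ?_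
  rw [valMinAbs_liftSite hle]
  exact ZMod.natAbs_valMinAbs_le (z i)

omit [NeZero M] in
/-- **Every site of the sup-norm ball of radius `M̄/2` is a lifted site** (`M̄` odd): it is the lift
of its coordinatewise reduction. [cite: Buchholz2016, Lemma 4.1] -/
theorem exists_liftSite_of_supNorm_le (hodd : Odd Mb) {x : Fin d → ZMod M}
    (hx : supNorm x ≤ Mb / 2) : ∃ z : Fin d → ZMod Mb, liftSite M z = x := by
  refine ⟨fun i => ((x i).valMinAbs : ZMod Mb), ?_⟩
  funext i
  simp only [liftSite]
  have hi : ((x i).valMinAbs).natAbs ≤ Mb / 2 := (natAbs_valMinAbs_le_supNorm x i).trans hx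
  have hval : (((x i).valMinAbs : ZMod Mb)).valMinAbs = (x i).valMinAbs := by
    rw [ZMod.valMinAbs_spec]
    refine ⟨rfl, ?_⟩
    obtain ⟨m, hm⟩ := hodd
    have h2 : ((x i).valMinAbs).natAbs * 2 ≤ Mb - 1 := by omega
    have h3 : (((x i).valMinAbs).natAbs : ℤ) * 2 ≤ (Mb : ℤ) - 1 := by
      have : (1 : ℕ) ≤ Mb := by omega
      exact_mod_cast (by omega : ((x i).valMinAbs).natAbs * 2 ≤ Mb - 1)
    rw [Int.natCast_natAbs] at h3
    constructor
    · linarith [neg_abs_le ((x i).valMinAbs)]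
    · linarith [le_abs_self ((x i).valMinAbs)]
  rw [hval, ZMod.coe_valMinAbs]

/-! ## The multipliers of the re-periodised kernel -/

/-- **The Fourier coefficients of the re-periodised kernel** ([Buc16] Lemma 4.1 / proof of Thm 4.5):
for a kernel `𝒞` on `(ℤ/M)^d` which is constant `= c₀` outside the sup-norm ball of radius `M̄/2`
(`M̄` odd, `M = r M̄`, `r ≥ 1`),
`(𝒞 ∘ lift)^(κ') = 𝒞̂(liftMode r κ') − c₀ · (M^d · 1[κ' = 0] − M̄^d · 1[κ' = 0])`.
[cite: Buchholz2016, Lemma 4.1] -/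
theorem fourierCoeff_comp_liftSite {r : ℕ} (hr : 1 ≤ r) (hM : M = r * Mb) (hodd : Odd Mb)
    {𝒞 : (Fin d → ZMod M) → ℝ} {c₀ : ℝ} (hfar : ∀ x, Mb / 2 < supNorm x → 𝒞 x = c₀)
    (κ : Fin d → ZMod Mb) :
    fourierCoeff (fun z => 𝒞 (liftSite M z)) κ =
      fourierCoeff 𝒞 (liftMode M r κ) -
        (c₀ : ℂ) * ((if κ = 0 then ((M : ℂ) ^ d) else 0) - (if κ = 0 then ((Mb : ℂ) ^ d) else 0)) := by
  classical
  have hle : Mb ≤ M := by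
    rw [hM]; exact Nat.le_mul_of_pos_left Mb (by omega)
  set S : Finset (Fin d → ZMod M) := univ.image (liftSite (Mb := Mb) M) with hS
  have hinj := liftSite_injective (d := d) hle
  -- outside the image the kernel is the constant `c₀`
  have hout : ∀ x, x ∉ S → 𝒞 x = c₀ := by
    intro x hx
    refine hfar x ?_
    by_contra h
    push Not at h
    obtain ⟨z, hz⟩ := exists_liftSite_of_supNorm_le hodd h
    exact hx (mem_image.2 ⟨z, mem_univ _, hz⟩)
  -- the big Fourier sum, split along `S`
  have hsplit : fourierCoeff 𝒞 (liftMode M r κ) =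
      ∑ x ∈ S, (𝒞 x : ℂ) * conj (torusChar (liftMode M r κ) x) +
        ∑ x ∈ univ \ S, (𝒞 x : ℂ) * conj (torusChar (liftMode M r κ) x) := by
    rw [fourierCoeff_eq_sum, ← sum_union (disjoint_sdiff), union_sdiff_of_subset (subset_univ S)]
  -- the sum over the image is the small Fourier sum
  have hin : ∑ x ∈ S, (𝒞 x : ℂ) * conj (torusChar (liftMode M r κ) x) = fourierCoeff (fun z => 𝒞 (liftSite M z)) κ := by
    rw [hS, sum_image (fun z _ z' _ h => hinj h), fourierCoeff_eq_sum]
    refine sum_congr rfl fun z _ => ?_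
    rw [torusChar_liftMode_liftSite hr hM hle]
  -- the sum over the complement is `c₀` times a difference of character sums
  have hchar_all : ∑ x, conj (torusChar (liftMode M r κ) x) = if κ = 0 then ((M : ℂ) ^ d) else 0 := by
    rw [← map_sum, sum_torusChar_right]
    simp only [liftMode_eq_zero_iff hr hM]
    split_ifs <;> simp
  have hchar_in : ∑ x ∈ S, conj (torusChar (liftMode M r κ) x) = if κ = 0 then ((Mb : ℂ) ^ d) else 0 := by
    rw [hS, sum_image (fun z _ z' _ h => hinj h)]
    simp_rw [torusChar_liftMode_liftSite hr hM hle]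
    rw [← map_sum, sum_torusChar_right]
    split_ifs <;> simp
  have hcompl : ∑ x ∈ univ \ S, (𝒞 x : ℂ) * conj (torusChar (liftMode M r κ) x) =
      (c₀ : ℂ) * ((if κ = 0 then ((M : ℂ) ^ d) else 0) - (if κ = 0 then ((Mb : ℂ) ^ d) else 0)) := by
    calc ∑ x ∈ univ \ S, (𝒞 x : ℂ) * conj (torusChar (liftMode M r κ) x)
        = ∑ x ∈ univ \ S, (c₀ : ℂ) * conj (torusChar (liftMode M r κ) x) := by
          refine sum_congr rfl fun x hx => ?_
          rw [hout x (mem_sdiff.1 hx).2]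
      _ = (c₀ : ℂ) * (∑ x, conj (torusChar (liftMode M r κ) x) - ∑ x ∈ S, conj (torusChar (liftMode M r κ) x)) := by
          rw [← mul_sum, ← sum_sdiff (subset_univ S), add_sub_cancel_right]
      _ = (c₀ : ℂ) * ((if κ = 0 then ((M : ℂ) ^ d) else 0) - (if κ = 0 then ((Mb : ℂ) ^ d) else 0)) := by
          rw [hchar_all, hchar_in]
  rw [hsplit, hin, hcompl]
  ring

/-- **The nonzero multipliers of the re-periodised kernel are a subset of the original ones**:
`(𝒞 ∘ lift)^(κ') = 𝒞̂(liftMode r κ')` for `κ' ≠ 0`. [cite: Buchholz2016, Lemma 4.1] -/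
theorem fourierCoeff_comp_liftSite_of_ne_zero {r : ℕ} (hr : 1 ≤ r) (hM : M = r * Mb) (hodd : Odd Mb)
    {𝒞 : (Fin d → ZMod M) → ℝ} {c₀ : ℝ} (hfar : ∀ x, Mb / 2 < supNorm x → 𝒞 x = c₀)
    {κ : Fin d → ZMod Mb} (hκ : κ ≠ 0) :
    fourierCoeff (fun z => 𝒞 (liftSite M z)) κ = fourierCoeff 𝒞 (liftMode M r κ) := by
  rw [fourierCoeff_comp_liftSite hr hM hodd hfar, if_neg hκ, if_neg hκ, sub_zero, mul_zero, sub_zero]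

/-- The zero mode of the re-periodised kernel: `(𝒞 ∘ lift)^(0) = 𝒞̂(0) − c₀ (M^d − M̄^d)` — it depends on
`𝒞` only through `𝒞̂(0)` and the far-field constant `c₀`. [cite: Buchholz2016, Lemma 4.1] -/
theorem fourierCoeff_comp_liftSite_zero {r : ℕ} (hr : 1 ≤ r) (hM : M = r * Mb) (hodd : Odd Mb)
    {𝒞 : (Fin d → ZMod M) → ℝ} {c₀ : ℝ} (hfar : ∀ x, Mb / 2 < supNorm x → 𝒞 x = c₀) :
    fourierCoeff (fun z : Fin d → ZMod Mb => 𝒞 (liftSite M z)) 0 =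
      fourierCoeff 𝒞 0 - (c₀ : ℂ) * ((M : ℂ) ^ d - (Mb : ℂ) ^ d) := by
  rw [fourierCoeff_comp_liftSite hr hM hodd hfar, if_pos rfl, if_pos rfl, (liftMode_eq_zero_iff hr hM 0).2 rfl]

/-! ## The projection and the covariance identity on small sets -/

/-- The coordinatewise projection `(ℤ/M)^d → (ℤ/M̄)^d` (`M̄ ∣ M`). [cite: Buchholz2016, Lemma 4.1 (the map τ)] -/
def projSite (h : Mb ∣ M) (x : Fin d → ZMod M) : Fin d → ZMod Mb := fun i => ZMod.castHom h (ZMod Mb) (x i)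

omit [NeZero M] [NeZero Mb] in
/-- The projection is additive. [cite: Buchholz2016, Lemma 4.1] -/
theorem projSite_sub (h : Mb ∣ M) (x y : Fin d → ZMod M) : projSite h (x - y) = projSite h x - projSite h y := by
  funext i; simp only [projSite, Pi.sub_apply, map_sub]

omit [NeZero M] in
/-- **`lift ∘ proj = id` on the sup-norm ball of radius `M̄/2`** (`M̄` odd). [cite: Buchholz2016, Lemma 4.1] -/
theorem liftSite_projSite (h : Mb ∣ M) (hodd : Odd Mb) {v : Fin d → ZMod M} (hv : supNorm v ≤ Mb / 2) :
    liftSite M (projSite h v) = v := by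
  obtain ⟨z, rfl⟩ := exists_liftSite_of_supNorm_le hodd hv
  congr 1
  funext i
  simp only [projSite, liftSite, ZMod.castHom_apply]
  rw [ZMod.cast_intCast h, ZMod.coe_valMinAbs]

omit [NeZero M] in
/-- **The covariance identity on small sets** ([Buc16] Lemma 4.1): for `|x − y|_∞ ≤ M̄/2`,
`(𝒞 ∘ lift)(proj x − proj y) = 𝒞(x − y)` — the re-periodised kernel on the small torus reproduces the
covariance of the big torus between sites at sup-distance at most `M̄/2`. [cite: Buchholz2016, Lemma 4.1] -/
theorem comp_liftSite_projSite_sub (h : Mb ∣ M) (hodd : Odd Mb) (𝒞 : (Fin d → ZMod M) → ℝ)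
    {x y : Fin d → ZMod M} (hxy : supNorm (x - y) ≤ Mb / 2) :
    𝒞 (liftSite M (projSite h x - projSite h y)) = 𝒞 (x - y) := by
  rw [← projSite_sub, liftSite_projSite h hodd hxy]

end Literature.MathematicalPhysics.StatisticalMechanics.GradientFRD

end
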